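import Literature.NumberTheory.GaloisRepresentations.EvenGaloisRep
import Literature.NumberTheory.GaloisRepresentations.ResidualGaloisRep
import Literature.NumberTheory.GaloisRepresentations.LabelledHodgeTateWeights
import Literature.NumberTheory.GaloisRepresentations.ModPGaloisRep
import Literature.NumberTheory.GaloisRepresentations.DecomposedGeneric
import Literature.NumberTheory.PAdicHodge.FontaineDpst
import Literature.NumberTheory.EllipticCurves.BinaryQuarticResolventEmbedding
import HarnessLib

/-!
# Calegari's theorem: regular even two-dimensional `p`-adic representations of a totally real
# field do not exist (Calegari, *Even Galois representations and the Fontaine–Mazur conjecture II*,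
# Theorem 1.2)

Topic `Literature/NumberTheory/GaloisRepresentations`.  NAMED FACT (D-0014): a published theorem
vendored as a `Prop` with a body, no proof; users take `(h : Calegari2011_thm_1_2)`.

F. Calegari, *Even Galois representations and the Fontaine–Mazur conjecture. II*, J. Amer. Math.
Soc. **25** (2012), 533–554 (bib `Calegari2011`; = arXiv:1012.4819, held text
`paper:arxiv-1012.4819`, the statements on p. 3, the proof in §§3–4), Theorem 1.2, verbatim:

> "Theorem 1.2. Let `F⁺` be a totally real field in which `p` splits completely. Let
> `ρ : G_{F⁺} → GL₂(Q̄_p)` be a continuous Galois representation unramified except at a finite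
> number of primes. Suppose that `p > 7`, and, furthermore, that
> * `ρ|D_v` is potentially semi-stable, with distinct Hodge–Tate weights, for all `v | p`.
> * The representation `Sym² ρ̄|_{G_{F⁺(ζ_p)}}` is irreducible.
> * If `v | p`, then `ρ̄|D_v` is not a twist of a representation of the form `(ε̄ * ; 0 1)`.
> Then, for every real place of `F⁺`, `ρ` is odd."

(`ε̄` "denotes the mod-`p` cyclotomic character"; `ρ̄` is the residual representation, p. 3:
"the image of `ρ` lands in `GL₂(O_L)` … Let `𝔽` denote the residue field, and let
`ρ̄ : G → GL₂(𝔽)` denote the corresponding residual representation".)  Theorem 1.1 (same page: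
`F⁺ = ℚ`, `ρ̄` absolutely irreducible and not of dihedral type, conclusion "`ρ` is modular") is
deduced from Theorem 1.2 and Kisin's Fontaine–Mazur theorem; it is NOT vendored here (the tree
has no modularity predicate for `ρ : Γ_ℚ → GL₂(ℚ̄_p)`), and its even case is what route
`Summits/Langlands/Langlands/Theses/EvenVoidBelowEight.lean` (cruxes `LargePrimesNoLocalShape`,
`FiveSevenSteinbergShadow`, `ThreeAdic…`) re-runs.  The proof (§§3–4): potential automorphy
produces from an even `ρ` a regular algebraic self-dual automorphic representation of `GL(9)`
over a totally real field whose Galois representation `ϱ = Sym² ρ ⊗ ρ_π` has `tr ϱ(c) = +3`,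
contradicting Taylor's sign theorem.

## Rendering of the hypotheses (tree vocabulary; every deviation is a SPECIALISATION of print)

* `F⁺` totally real: `F : Type` a number field with `NumberField.IsTotallyReal F`; "`p` splits
  completely": the tree's `SplitsCompletely F p` (`DecomposedGeneric.lean`: unramified above
  `p` and every `v ∣ p` has residue field of cardinality `p`).  `7 < p`.
* `ρ : FramedGaloisRep F (PadicAlgCl p) 2` (`ℚ̄_p = PadicAlgCl p`; continuity is built in);
  "unramified except at a finite number of primes": `∀ᶠ v in cofinite, ρ.IsUnramifiedAt v`.
* (1) "`ρ|D_v` potentially semi-stable with distinct Hodge–Tate weights for all `v ∣ p`":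
  rendered exactly as in the route file `EvenVoidBelowEight.lean` — de Rham for the pinned
  Fontaine datum `fontainePstAdicCompletion v p hv` of `F_v` (`IsDeRhamFramed (ρ.toLocal v)`;
  over a `p`-adic field de Rham = potentially semistable, Berger 2002) and, for every
  CONTINUOUS label `τ : F_v →+* ℚ̄_p`, the multiset `ρ.labelledHodgeTateWeightsAt v … τ` is
  multiplicity-free (`Nodup`; `F_v = ℚ_p` here, so there is one label).
* (2) "`Sym² ρ̄|_{G_{F⁺(ζ_p)}}` is irreducible": `ρ̄ = ρ.residualRep : Γ_F →* GL₂(k)`,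
  `k = padicAlgClResidueField p` (the chosen residual representation of `ResidualGaloisRep.lean`;
  under (2) `ρ̄` is irreducible, hence well defined up to conjugacy, and (2), (3) are conjugation
  invariant); `G_{F⁺(ζ_p)} = ker ε̄_p ≤ Γ_F` with `ε̄_p = modPCyclotomicCharacterZMod F p`
  (`ModPGaloisRep.lean`); `Sym²` of a homomorphism into `GL₂` is the explicit
  `Matrix.GeneralLinearGroup.symSq` below (the tree's matrix `TernaryPairs.symSq`, basis
  `e₁², e₁e₂, e₂²`); "irreducible" is rendered
  ABSOLUTELY irreducible (`IsAbsIrreducible`, `ResidualGaloisRep.lean`) — `k` is an algebraic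
  closure of `𝔽_p`, and in any case this only strengthens the hypothesis.
* (3) "`ρ̄|D_v` is not a twist of `(ε̄ * ; 0 1)`" for `v ∣ p`: `D_v` = the image of
  `absGaloisRestrict F F_v : Γ_{F_v} → Γ_F` (`F_v = v.adicCompletion F`; well defined up to
  conjugacy); the shape says: there are a character `χ : Γ_{F_v} →* kˣ` and a frame
  `P ∈ GL₂(k)` with `P⁻¹ ρ̄(g) P = (χ(g) ε̄(g)  * ; 0  χ(g))` for all `g ∈ Γ_{F_v}` (any `*`),
  where `ε̄(g) ∈ (ℤ/p)ˣ` is read in `k` through the canonical `ℤ/p →+* k`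
  (`zmodToPadicAlgClResidueField`; `k` has characteristic `p`, `charP_padicAlgClResidueField`,
  proved here).
* Conclusion "for every real place of `F⁺`, `ρ` is odd": `ρ.IsOdd` (`GaloisRep.lean`:
  `det ρ(c) = -1` for every complex conjugation `c` of every real embedding).

## Contents

* `Matrix.symSqMonoidHom`, `Matrix.GeneralLinearGroup.symSq` — the symmetric square
  `GL₂ → GL₃`, packaging the tree's matrix `TernaryPairs.symSq` (whose multiplicativity is proved
  in `BinaryQuarticResolventEmbedding.lean`), with `Matrix.symSq_diagonal` (convention check)
  and `GeneralLinearGroup.det_symSq`.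
* `charP_padicAlgClResidueField` (PROVED: `ℤ̄_p/𝔪` has characteristic `p`) and the canonical
  `zmodToPadicAlgClResidueField : ℤ/p →+* ℤ̄_p/𝔪`.
* `IsTwistOfExtOneBy σ ψ` — the local shape predicate "`σ` is a twist of `(ψ * ; 0 1)`"
  (a definition), `isTwistOfExtOneBy_iff`, `isTwistOfExtOneBy_one`.
* `Calegari2011_thm_1_2` — the NAMED FACT.
* `Calegari2011_thm_1_2.not_isEven` — proved corollary: under the same hypotheses an EVEN `ρ`
  does not exist (`FramedGaloisRep.IsEven.not_isOdd`), the form the even-void routes consume.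

## References

* [Calegari2011] F. Calegari, *Even Galois representations and the Fontaine–Mazur conjecture.
  II*, J. Amer. Math. Soc. 25 (2012) 533–554, doi:10.1090/s0894-0347-2011-00721-2
  = arXiv:1012.4819: Thm. 1.1, Thm. 1.2, Rem. 1.3 (p. 3), §§3–4.  Read 2026-08-17 (arXiv text).
* [Calegari2010] F. Calegari, *Even Galois representations and the Fontaine–Mazur conjecture*,
  Invent. Math. 185 (2011) 1–16 (the ordinary case; tree fact `Calegari2010_thm_1_4`).
-/

noncomputable section

open Field IsDedekindDomain
open scoped NumberField MatrixGroups

/-! ### The symmetric square `GL₂ → GL₃` -/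

namespace Matrix

open Literature.NumberTheory.EllipticCurves

variable {R : Type*} [CommRing R]

/-- Convention check for the tree's symmetric-square matrix
`Literature.NumberTheory.EllipticCurves.TernaryPairs.symSq` (`BinaryQuarticResolventEmbedding.lean`:
`symSq A = (a²  ab  b² ; 2ac  ad+bc  2bd ; c²  cd  d²)` for `A = (a b; c d)`, the matrix of `Sym² A`
on `Sym²(R²)` in the basis `(e₁², e₁e₂, e₂²)` for the column action, equivalently
`ver(v A) = ver(v) · symSq A` for the Veronese row vector `ver(x, y) = (x², xy, y²)`,
`TernaryPairs.veronese_vecMul_symSq`): `Sym² diag(a, d) = diag(a², ad, d²)`. [folklore] -/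
theorem symSq_diagonal (a d : R) :
    TernaryPairs.symSq (Matrix.diagonal ![a, d]) = Matrix.diagonal ![a ^ 2, a * d, d ^ 2] := by
  ext i j
  fin_cases i <;> fin_cases j <;> simp [TernaryPairs.symSq, Matrix.diagonal]

/-- The symmetric square as a monoid homomorphism on `2 × 2` matrices, packaging the tree's
`TernaryPairs.symSq` with `TernaryPairs.symSq_one`, `TernaryPairs.symSq_mul`
(`BinaryQuarticResolventEmbedding.lean`, after Bhargava–Shankar's `ρ : PGL₂ → SO(A₁)`).
Declared in the `Matrix` namespace on purpose. [folklore] -/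
def symSqMonoidHom : Matrix (Fin 2) (Fin 2) R →* Matrix (Fin 3) (Fin 3) R where
  toFun := TernaryPairs.symSq
  map_one' := TernaryPairs.symSq_one
  map_mul' := TernaryPairs.symSq_mul

/-- Unfolding lemma for `symSqMonoidHom`. [folklore] -/
@[simp] theorem symSqMonoidHom_apply (A : Matrix (Fin 2) (Fin 2) R) :
    symSqMonoidHom A = TernaryPairs.symSq A := rfl

/-- **The symmetric square `Sym² : GL₂(R) → GL₃(R)`** (`Units.map` of `symSqMonoidHom`); for a
homomorphism `σ : G →* GL₂(R)`, `Sym² σ = GeneralLinearGroup.symSq ∘ σ`.  Declared in the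
`Matrix.GeneralLinearGroup` namespace on purpose. [folklore] -/
def GeneralLinearGroup.symSq : GL (Fin 2) R →* GL (Fin 3) R :=
  Units.map (symSqMonoidHom (R := R))

/-- Underlying matrix of `GeneralLinearGroup.symSq g`. [folklore] -/
@[simp] theorem GeneralLinearGroup.coe_symSq (g : GL (Fin 2) R) :
    ((GeneralLinearGroup.symSq g : GL (Fin 3) R) : Matrix (Fin 3) (Fin 3) R) =
      TernaryPairs.symSq (g : Matrix (Fin 2) (Fin 2) R) := rfl

/-- `det (Sym² g) = (det g)³` (`TernaryPairs.det_symSq`). [folklore] -/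
theorem GeneralLinearGroup.det_symSq (g : GL (Fin 2) R) :
    (Matrix.GeneralLinearGroup.det (GeneralLinearGroup.symSq g) : R) =
      (Matrix.GeneralLinearGroup.det g : R) ^ 3 := by
  simp [Matrix.GeneralLinearGroup.val_det_apply, TernaryPairs.det_symSq]

end Matrix

namespace Literature.NumberTheory.GaloisRepresentations

open Literature.NumberTheory.PAdicHodge
open scoped NNReal

/-! ### The residue field `ℤ̄_p/𝔪` has characteristic `p` -/

section ResidueChar

variable (p : ℕ) [Fact p.Prime]

/-- **`ℤ̄_p/𝔪` has characteristic `p`**: `p ∈ 𝔪` because `v(p) = 1/p < 1`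
(`PadicAlgCl.valuation_p`), so `p` is not a unit of the valuation ring `ℤ̄_p = padicAlgClIntegers p`
(a unit `u` would give `v(p) v(u⁻¹) = 1` with `v(u⁻¹) ≤ 1`), i.e. `p = 0` in the residue field
(`IsLocalRing.residue_eq_zero_iff`), which for a prime is `CharP` (`CharP.charP_iff_prime_eq_zero`).
[folklore] -/
theorem charP_padicAlgClResidueField : CharP (padicAlgClResidueField p) p := by
  have hp : p.Prime := Fact.out
  refine (CharP.charP_iff_prime_eq_zero hp).2 ?_
  have hvp : Valued.v ((p : padicAlgClIntegers p) : PadicAlgCl p) < 1 := by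
    have : ((p : padicAlgClIntegers p) : PadicAlgCl p) = (p : PadicAlgCl p) := by simp
    rw [this, PadicAlgCl.valuation_p, one_div]
    exact inv_lt_one_of_one_lt₀ (by exact_mod_cast hp.one_lt)
  have hunit : ¬ IsUnit (p : padicAlgClIntegers p) := by
    rintro ⟨u, hu⟩
    have hle : Valued.v ((↑(u⁻¹ : (padicAlgClIntegers p)ˣ) : padicAlgClIntegers p) :
        PadicAlgCl p) ≤ 1 :=
      (Valuation.mem_valuationSubring_iff _ _).1
        (↑(u⁻¹ : (padicAlgClIntegers p)ˣ) : padicAlgClIntegers p).2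
    have hprod : Valued.v ((p : padicAlgClIntegers p) : PadicAlgCl p) *
        Valued.v ((↑(u⁻¹ : (padicAlgClIntegers p)ˣ) : padicAlgClIntegers p) :
          PadicAlgCl p) = 1 := by
      rw [← map_mul, ← hu]
      have : ((u : padicAlgClIntegers p) : PadicAlgCl p) *
          ((↑(u⁻¹ : (padicAlgClIntegers p)ˣ) : padicAlgClIntegers p) : PadicAlgCl p) = 1 := by
        rw [← Subring.coe_mul]
        simp
      rw [this, map_one]
    exact absurd hprod (mul_lt_one_of_lt_of_le hvp hle).ne
  have hcast : (p : padicAlgClResidueField p) =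
      IsLocalRing.residue (padicAlgClIntegers p) (p : padicAlgClIntegers p) := by
    simp [map_natCast]
  rw [hcast, IsLocalRing.residue_eq_zero_iff]
  exact hunit

/-- The canonical ring homomorphism `ℤ/p →+* ℤ̄_p/𝔪` (`ZMod.castHom`, available by
`charP_padicAlgClResidueField`); through it the mod-`p` cyclotomic character
`Γ_F → (ℤ/p)ˣ` is read in the residue field of `ℚ̄_p`. [folklore] -/
def zmodToPadicAlgClResidueField : ZMod p →+* padicAlgClResidueField p :=
  haveI := charP_padicAlgClResidueField p
  ZMod.castHom (dvd_refl p) (padicAlgClResidueField p)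

end ResidueChar

/-! ### The local shape `χ ⊗ (ψ * ; 0 1)` -/

section Shape

variable {G : Type*} [Group G] {k : Type*} [CommRing k]

/-- **`σ : G →* GL₂(k)` is a twist of a representation of the form `(ψ * ; 0 1)`**: there are a
character `χ : G →* kˣ` and a frame `P ∈ GL₂(k)` such that, for every `g`,
`P⁻¹ σ(g) P = (χ(g) ψ(g)  * ; 0  χ(g))` — upper triangular (entry `(1,0)` zero), lower-right
entry `χ(g)`, upper-left entry `χ(g) ψ(g)`, the entry `*` arbitrary (zero allowed).  With
`ψ = ε̄_p` this is Calegari's local hypothesis shape "`ρ̄|D_v` is a twist of `(ε̄ * ; 0 1)`"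
(Thm. 1.1–1.2, p. 3). [cite: Calegari2011, Thm. 1.2, third hypothesis] -/
def IsTwistOfExtOneBy (σ : G →* GL (Fin 2) k) (ψ : G → k) : Prop :=
  ∃ (χ : G →* kˣ) (P : GL (Fin 2) k), ∀ g : G,
    ((P⁻¹ * σ g * P : GL (Fin 2) k) : Matrix (Fin 2) (Fin 2) k) 1 0 = 0 ∧
      ((P⁻¹ * σ g * P : GL (Fin 2) k) : Matrix (Fin 2) (Fin 2) k) 1 1 = (χ g : k) ∧
        ((P⁻¹ * σ g * P : GL (Fin 2) k) : Matrix (Fin 2) (Fin 2) k) 0 0 = (χ g : k) * ψ g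

/-- Unfolding lemma for `IsTwistOfExtOneBy`. [folklore] -/
theorem isTwistOfExtOneBy_iff (σ : G →* GL (Fin 2) k) (ψ : G → k) :
    IsTwistOfExtOneBy σ ψ ↔
      ∃ (χ : G →* kˣ) (P : GL (Fin 2) k), ∀ g : G,
        ((P⁻¹ * σ g * P : GL (Fin 2) k) : Matrix (Fin 2) (Fin 2) k) 1 0 = 0 ∧
          ((P⁻¹ * σ g * P : GL (Fin 2) k) : Matrix (Fin 2) (Fin 2) k) 1 1 = (χ g : k) ∧
            ((P⁻¹ * σ g * P : GL (Fin 2) k) : Matrix (Fin 2) (Fin 2) k) 0 0 = (χ g : k) * ψ g :=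
  Iff.rfl

/-- Non-vacuity: the trivial representation has the shape for `ψ = 1` (with `χ = 1`, `P = 1`,
`* = 0`). [folklore] -/
theorem isTwistOfExtOneBy_one : IsTwistOfExtOneBy (1 : G →* GL (Fin 2) k) (fun _ => 1) := by
  refine ⟨1, 1, fun g => ?_⟩
  simp

end Shape

/-! ### The named fact -/

/-- **Calegari 2011 (J. Amer. Math. Soc. 25 (2012) 533–554 = arXiv:1012.4819), Theorem 1.2**
(p. 3 of the arXiv text): "Let `F⁺` be a totally real field in
which `p` splits completely. Let `ρ : G_{F⁺} → GL₂(Q̄_p)` be a continuous Galois representation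
unramified except at a finite number of primes. Suppose that `p > 7`, and, furthermore, that
(1) `ρ|D_v` is potentially semi-stable, with distinct Hodge–Tate weights, for all `v | p`;
(2) the representation `Sym² ρ̄|_{G_{F⁺(ζ_p)}}` is irreducible; (3) if `v | p`, then `ρ̄|D_v` is
not a twist of a representation of the form `(ε̄ * ; 0 1)` [`ε̄` the mod-`p` cyclotomic
character]. Then, for every real place of `F⁺`, `ρ` is odd."  Rendering (module docstring):
`IsTotallyReal F`, `SplitsCompletely F p`, `7 < p`; (1) = de Rham for the pinned Fontaine datum
of `F_v` with multiplicity-free labelled Hodge–Tate weights for every continuous label (as in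
route `EvenVoidBelowEight`); (2) = `Sym²` (`Matrix.GeneralLinearGroup.symSq`) of the residual
representation `ρ.residualRep`, restricted to `ker ε̄_p = Γ_{F(ζ_p)}`, is absolutely irreducible;
(3) = there is no character `χ` of `Γ_{F_v}` and frame `P` with
`P⁻¹ ρ̄(g) P = (χ(g) ε̄(g)  * ; 0  χ(g))` on the decomposition group (`g ∈ Γ_{F_v}` through
`absGaloisRestrict F F_v`; `ε̄` read in the residue field `k` of `ℤ̄_p` through the canonical
`ℤ/p →+* k`, `zmodToPadicAlgClResidueField`, `k` having characteristic `p` by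
`charP_padicAlgClResidueField`) — the predicate `IsTwistOfExtOneBy`; conclusion `ρ.IsOdd`.  Theorem 1.1 (`F⁺ = ℚ`, "`ρ` is modular") and
the even-case contradiction are in `Calegari2011_thm_1_2.not_isEven` / the route.
[cite: Calegari2011, Thm. 1.2 (p. 3 of arXiv:1012.4819)] -/
def Calegari2011_thm_1_2 : Prop :=
  ∀ (F : Type) [Field F] [NumberField F], NumberField.IsTotallyReal F →
  ∀ (p : ℕ) [Fact p.Prime], 7 < p → SplitsCompletely F p →
  ∀ (ρ : FramedGaloisRep F (PadicAlgCl p) 2),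
    (∀ᶠ v : HeightOneSpectrum (𝓞 F) in Filter.cofinite, ρ.IsUnramifiedAt v) →
    -- (1) potentially semistable with distinct Hodge–Tate weights at every `v ∣ p`
    (∀ (v : HeightOneSpectrum (𝓞 F)) (hv : ((p : ℕ) : 𝓞 F) ∈ v.asIdeal),
      (fontainePstAdicCompletion v p hv).IsDeRhamFramed (ρ.toLocal v) ∧
        ∀ τ : v.adicCompletion F →+* PadicAlgCl p, Continuous τ →
          (ρ.labelledHodgeTateWeightsAt v (fontainePstAdicCompletion v p hv).algebra
            (fontainePstAdicCompletion v p hv).𝔅 τ).Nodup) →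
    -- (2) `Sym² ρ̄ |_{Γ_{F(ζ_p)}}` is (absolutely) irreducible
    IsAbsIrreducible
      ((Matrix.GeneralLinearGroup.symSq.comp ρ.residualRep).comp
        (modPCyclotomicCharacterZMod F p).ker.subtype) →
    -- (3) for `v ∣ p`, `ρ̄|D_v` is not a twist of `(ε̄ * ; 0 1)`
    (∀ (v : HeightOneSpectrum (𝓞 F)), ((p : ℕ) : 𝓞 F) ∈ v.asIdeal →
      ¬ IsTwistOfExtOneBy
          (ρ.residualRep.comp (absGaloisRestrict F (v.adicCompletion F)).toMonoidHom)
          (fun g => zmodToPadicAlgClResidueField p ((modPCyclotomicCharacterZMod F p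
            (absGaloisRestrict F (v.adicCompletion F) g) : (ZMod p)ˣ) : ZMod p))) →
    ρ.IsOdd

/-- **Corollary (the even case is void).** Under the hypotheses of Calegari 2011 Thm. 1.2 an
EVEN `ρ` cannot exist: `F` has a real embedding `φ` (supplied explicitly — every totally real
number field has one), `ρ` is odd there by the fact, and even/odd are exclusive since `2 ≠ 0`
in `ℚ̄_p` (`FramedGaloisRep.IsEven.not_isOdd`).  This is the shape of the even-void route items
(`Summits/Langlands/Langlands/Theses/EvenVoidBelowEight.lean`), which over `ℚ` also drop the
local-shape hypothesis (3) and lower `p`. [cite: Calegari2011, Thm. 1.2 and the paragraph after Thm. 1.1 ("it suffices to assume that ρ is even and derive a contradiction")] -/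
theorem Calegari2011_thm_1_2.not_isEven (h : Calegari2011_thm_1_2)
    (F : Type) [Field F] [NumberField F] (hF : NumberField.IsTotallyReal F) (φ : F →+* ℝ)
    (p : ℕ) [Fact p.Prime] (hp : 7 < p) (hsplit : SplitsCompletely F p)
    (ρ : FramedGaloisRep F (PadicAlgCl p) 2)
    (hur : ∀ᶠ v : HeightOneSpectrum (𝓞 F) in Filter.cofinite, ρ.IsUnramifiedAt v)
    (hpst : ∀ (v : HeightOneSpectrum (𝓞 F)) (hv : ((p : ℕ) : 𝓞 F) ∈ v.asIdeal),
      (fontainePstAdicCompletion v p hv).IsDeRhamFramed (ρ.toLocal v) ∧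
        ∀ τ : v.adicCompletion F →+* PadicAlgCl p, Continuous τ →
          (ρ.labelledHodgeTateWeightsAt v (fontainePstAdicCompletion v p hv).algebra
            (fontainePstAdicCompletion v p hv).𝔅 τ).Nodup)
    (hsym : IsAbsIrreducible
      ((Matrix.GeneralLinearGroup.symSq.comp ρ.residualRep).comp
        (modPCyclotomicCharacterZMod F p).ker.subtype))
    (hloc : ∀ (v : HeightOneSpectrum (𝓞 F)), ((p : ℕ) : 𝓞 F) ∈ v.asIdeal →
      ¬ IsTwistOfExtOneBy
          (ρ.residualRep.comp (absGaloisRestrict F (v.adicCompletion F)).toMonoidHom)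
          (fun g => zmodToPadicAlgClResidueField p ((modPCyclotomicCharacterZMod F p
            (absGaloisRestrict F (v.adicCompletion F) g) : (ZMod p)ˣ) : ZMod p)))
    (hev : ρ.IsEven) : False :=
  hev.not_isOdd φ two_ne_zero (h F hF p hp hsplit ρ hur hpst hsym hloc)

end Literature.NumberTheory.GaloisRepresentations

end
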